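import Mathlib
import Summits.ValiantsHypothesis.ValiantsHypothesis.Theorems.ProofCarryingSymmetryRestorationQPUnitEq

/-!
# Route ProofCarryingSymmetry — crux `RestorationQP`, line `registered`, rung S3⁗ under stub S2″ (`stub_proofsToACEquiv`), part 1:
Hrubeš–Tzameret formulas modulo everything but distributivity

Rung S3‴ (`…RestorationQPUnitStability.lean`) allows the unit laws A7–A9 in the invariance proofs.
Rung S3⁗ allows moreover the CONSTANT EQUATIONS A10 (`a = b + c`, `a = b · c` whenever true in the
field of constants), so that only DISTRIBUTIVITY A6 is excluded.  This file is the term-level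
groundwork, for formulas `PIFormula 𝔽 X` over a commutative semiring of constants:

* `UCEq` — the congruence generated by A1–A5, A7–A9 and A10 (the "distributivity-free fragment" of
  `P_f`); it contains `UEq` and `ACEq` (`UEq.toUCEq`, `ACEq.toUCEq`), preserves `eval`
  (`UCEq.eval_eq`) and is stable under renaming (`UCEq.rename`);
* `IsDist s` — the excluded scheme A6;
* SOUNDNESS: a `P_f` proof with no instance of A6 relates `UCEq`-equivalent formulas
  (`ucEq_of_pfProof`, `ucEq_of_pfProvable`), and a `P_c` proof with no instance of A6 relates
  circuits with `UCEq`-equivalent unfoldings (`ucEq_unfold_of_pcProof`, `ucEq_unfold_of_hasPCProof`).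

Everything is elementary and proved; no named facts. (HT = Hrubeš–Tzameret, arXiv:1112.6265 §1.1.)
-/

-- single-problem summit: `Summit.ValiantsHypothesis.ValiantsHypothesis.…` is the namespace by design (D-0017)
set_option linter.dupNamespace false

namespace Summit.ValiantsHypothesis.ValiantsHypothesis.Theorems

namespace ACStability

open Literature.Computability.AlgebraicComplexity

universe u v w

variable {𝔽 : Type u} [CommSemiring 𝔽] {X : Type v} {Y : Type w}

/-! ### The distributivity-free congruence -/

/-- `UCEq F G`: `F = G` is derivable in the fragment of Hrubeš–Tzameret's `P_f` with the axioms
A1–A5 (reflexivity, commutativity and associativity of `+` and `×`), the unit laws A7–A9, the true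
constant equations A10 `a = b + c`, `a = b · c`, and the rules R1–R4 — everything except
distributivity A6. [folklore] -/
inductive UCEq : PIFormula 𝔽 X → PIFormula 𝔽 X → Prop
  /-- A1 -/
  | refl (F : PIFormula 𝔽 X) : UCEq F F
  /-- R1 -/
  | symm {F G : PIFormula 𝔽 X} : UCEq F G → UCEq G F
  /-- R2 -/
  | trans {F G H : PIFormula 𝔽 X} : UCEq F G → UCEq G H → UCEq F H
  /-- R3 -/
  | add_congr {F F' G G' : PIFormula 𝔽 X} : UCEq F F' → UCEq G G' → UCEq (.add F G) (.add F' G')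
  /-- R4 -/
  | mul_congr {F F' G G' : PIFormula 𝔽 X} : UCEq F F' → UCEq G G' → UCEq (.mul F G) (.mul F' G')
  /-- A2 -/
  | add_comm (F G : PIFormula 𝔽 X) : UCEq (.add F G) (.add G F)
  /-- A3 -/
  | add_assoc (F G H : PIFormula 𝔽 X) : UCEq (.add F (.add G H)) (.add (.add F G) H)
  /-- A4 -/
  | mul_comm (F G : PIFormula 𝔽 X) : UCEq (.mul F G) (.mul G F)
  /-- A5 -/
  | mul_assoc (F G H : PIFormula 𝔽 X) : UCEq (.mul F (.mul G H)) (.mul (.mul F G) H)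
  /-- A7 -/
  | add_zero (F : PIFormula 𝔽 X) : UCEq (.add F (.const 0)) F
  /-- A8 -/
  | mul_zero (F : PIFormula 𝔽 X) : UCEq (.mul F (.const 0)) (.const 0)
  /-- A9 -/
  | mul_one (F : PIFormula 𝔽 X) : UCEq (.mul F (.const 1)) F
  /-- A10, additive -/
  | const_add (a b c : 𝔽) (h : a = b + c) : UCEq (.const a) (.add (.const b) (.const c))
  /-- A10, multiplicative -/
  | const_mul (a b c : 𝔽) (h : a = b * c) : UCEq (.const a) (.mul (.const b) (.const c))

/-- ACU-equivalent formulas are UC-equivalent. [folklore] -/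
theorem UEq.toUCEq {F G : PIFormula 𝔽 X} (h : UEq F G) : UCEq F G := by
  induction h with
  | refl F => exact .refl _
  | symm _ ih => exact ih.symm
  | trans _ _ ih₁ ih₂ => exact ih₁.trans ih₂
  | add_congr _ _ ih₁ ih₂ => exact .add_congr ih₁ ih₂
  | mul_congr _ _ ih₁ ih₂ => exact .mul_congr ih₁ ih₂
  | add_comm F G => exact .add_comm _ _
  | add_assoc F G H => exact .add_assoc _ _ _
  | mul_comm F G => exact .mul_comm _ _
  | mul_assoc F G H => exact .mul_assoc _ _ _
  | add_zero F => exact .add_zero _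
  | mul_zero F => exact .mul_zero _
  | mul_one F => exact .mul_one _

/-- AC-equivalent formulas are UC-equivalent. [folklore] -/
theorem ACEq.toUCEq {F G : PIFormula 𝔽 X} (h : ACEq F G) : UCEq F G :=
  h.toUEq.toUCEq

/-- `UCEq` is stable under renaming of the variables. [folklore] -/
theorem UCEq.rename (f : X → Y) {F G : PIFormula 𝔽 X} (h : UCEq F G) :
    UCEq (F.rename f) (G.rename f) := by
  induction h with
  | refl F => exact .refl _
  | symm _ ih => exact ih.symm
  | trans _ _ ih₁ ih₂ => exact ih₁.trans ih₂
  | add_congr _ _ ih₁ ih₂ => exact .add_congr ih₁ ih₂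
  | mul_congr _ _ ih₁ ih₂ => exact .mul_congr ih₁ ih₂
  | add_comm F G => exact .add_comm _ _
  | add_assoc F G H => exact .add_assoc _ _ _
  | mul_comm F G => exact .mul_comm _ _
  | mul_assoc F G H => exact .mul_assoc _ _ _
  | add_zero F => exact .add_zero _
  | mul_zero F => exact .mul_zero _
  | mul_one F => exact .mul_one _
  | const_add a b c h => exact .const_add a b c h
  | const_mul a b c h => exact .const_mul a b c h

/-- UC-equivalent formulas compute the same polynomial (soundness of A2–A5, A7–A10). [folklore] -/
theorem UCEq.eval_eq {F G : PIFormula 𝔽 X} (h : UCEq F G) : F.eval = G.eval := by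
  induction h with
  | refl F => rfl
  | symm _ ih => exact ih.symm
  | trans _ _ ih₁ ih₂ => exact ih₁.trans ih₂
  | add_congr _ _ ih₁ ih₂ => simp [ih₁, ih₂]
  | mul_congr _ _ ih₁ ih₂ => simp [ih₁, ih₂]
  | add_comm F G => simpa using _root_.add_comm F.eval G.eval
  | add_assoc F G H => simpa using (_root_.add_assoc F.eval G.eval H.eval).symm
  | mul_comm F G => simpa using _root_.mul_comm F.eval G.eval
  | mul_assoc F G H => simpa using (_root_.mul_assoc F.eval G.eval H.eval).symm
  | add_zero F => simp
  | mul_zero F => simp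
  | mul_one F => simp
  | const_add a b c h => simp [h]
  | const_mul a b c h => simp [h]

/-! ### Soundness of distributivity-free proofs -/

/-- The excluded scheme: A6 (distributivity). [folklore] -/
def IsDist (s : PIAxiom) : Prop :=
  s = PIAxiom.A6

/-- A6 is among A6, A10. [folklore] -/
theorem IsDist.isDistConst {s : PIAxiom} (hs : IsDist s) : IsDistConst s := Or.inl hs

/-! #### `P_f` -/

/-- An instance of a scheme other than A6 on formulas relates UC-equivalent formulas. [folklore] -/
theorem ucEq_of_ringAxiom_pf {s : PIAxiom} (hs : ¬ IsDist s) {F G : PIFormula 𝔽 X}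
    (h : (pfSystem 𝔽 X).RingAxiom s F G) : UCEq F G := by
  cases h with
  | a1 F => exact .refl _
  | a2 F G => exact UCEq.add_comm F G
  | a3 F G H => exact UCEq.add_assoc F G H
  | a4 F G => exact UCEq.mul_comm F G
  | a5 F G H => exact UCEq.mul_assoc F G H
  | a6 F G H => exact absurd rfl hs
  | a7 _ => exact UCEq.add_zero _
  | a8 _ => exact UCEq.mul_zero _
  | a9 _ => exact UCEq.mul_one _
  | a10_add a b c h => exact UCEq.const_add a b c h
  | a10_mul a b c h => exact UCEq.const_mul a b c h

/-- **Soundness for `P_f`.** In a `P_f` proof with no instance of A6, every line relates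
UC-equivalent formulas. [folklore] -/
theorem ucEq_of_pfProof {Γ : List (PIFormula 𝔽 X × PIFormula 𝔽 X)} (π : PFProof 𝔽 X Γ)
    (h : ∀ s, IsDist s → π.axiomCount s = 0) :
    ∀ {F G : PIFormula 𝔽 X}, (F, G) ∈ Γ → UCEq F G := by
  induction π with
  | nil => intro F G hm; simp at hm
  | axm s' hax π ih =>
    intro F G hm
    have hπ : ∀ s, IsDist s → π.axiomCount s = 0 := fun s hs => by
      have := h s hs; simp only [PIProof.axiomCount] at this; omega
    have hs' : ¬ IsDist s' := fun hs => by
      have := h s' hs; simp [PIProof.axiomCount] at this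
    rcases List.mem_cons.1 hm with hm | hm
    · obtain ⟨rfl, rfl⟩ := Prod.mk.injEq _ _ _ _ ▸ hm
      rcases hax with hax | hax
      · exact ucEq_of_ringAxiom_pf hs' hax
      · exact hax.elim
    · exact ih hπ hm
  | symm hm' π ih =>
    intro F G hm
    rcases List.mem_cons.1 hm with hm | hm
    · obtain ⟨rfl, rfl⟩ := Prod.mk.injEq _ _ _ _ ▸ hm
      exact (ih h hm').symm
    · exact ih h hm
  | trans h₁ h₂ π ih =>
    intro F G hm
    rcases List.mem_cons.1 hm with hm | hm
    · obtain ⟨rfl, rfl⟩ := Prod.mk.injEq _ _ _ _ ▸ hm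
      exact (ih h h₁).trans (ih h h₂)
    · exact ih h hm
  | addRule h₁ h₂ hF hG π ih =>
    intro F G hm
    rcases List.mem_cons.1 hm with hm | hm
    · obtain ⟨rfl, rfl⟩ := Prod.mk.injEq _ _ _ _ ▸ hm
      subst hF hG
      exact UCEq.add_congr (ih h h₁) (ih h h₂)
    · exact ih h hm
  | mulRule h₁ h₂ hF hG π ih =>
    intro F G hm
    rcases List.mem_cons.1 hm with hm | hm
    · obtain ⟨rfl, rfl⟩ := Prod.mk.injEq _ _ _ _ ▸ hm
      subst hF hG
      exact UCEq.mul_congr (ih h h₁) (ih h h₂)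
    · exact ih h hm

/-- `P_f`-provability within a budget vanishing on A6 forces UC-equivalence. [folklore] -/
theorem ucEq_of_pfProvable {F G : PIFormula 𝔽 X} {b : PIAxiom → ℕ∞}
    (hb : ∀ s, IsDist s → b s = 0) (h : (pfSystem 𝔽 X).Provable F G ⊤ b) : UCEq F G := by
  obtain ⟨Γ, π, -, hπ⟩ := h
  refine ucEq_of_pfProof π (fun s hs => ?_) List.mem_cons_self
  have := hπ s
  rw [hb s hs, nonpos_iff_eq_zero, Nat.cast_eq_zero] at this
  exact this

/-! #### `P_c` -/

/-- An instance of a scheme other than A6 on circuits relates circuits with UC-equivalent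
unfoldings. [folklore] -/
theorem ucEq_unfold_of_ringAxiom {s : PIAxiom} (hs : ¬ IsDist s) {F G : PICircuit 𝔽 X}
    (h : (pcSystem 𝔽 X).RingAxiom s F G) : UCEq F.unfold G.unfold := by
  cases h with
  | a1 F => exact .refl _
  | a2 F G => simpa [pcSystem] using UCEq.add_comm F.unfold G.unfold
  | a3 F G H => simpa [pcSystem] using UCEq.add_assoc F.unfold G.unfold H.unfold
  | a4 F G => simpa [pcSystem] using UCEq.mul_comm F.unfold G.unfold
  | a5 F G H => simpa [pcSystem] using UCEq.mul_assoc F.unfold G.unfold H.unfold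
  | a6 F G H => exact absurd rfl hs
  | a7 _ =>
    simp only [pcSystem, PICircuit.unfold_add, PICircuit.unfold_const]
    exact UCEq.add_zero _
  | a8 _ =>
    simp only [pcSystem, PICircuit.unfold_mul, PICircuit.unfold_const]
    exact UCEq.mul_zero _
  | a9 _ =>
    simp only [pcSystem, PICircuit.unfold_mul, PICircuit.unfold_const]
    exact UCEq.mul_one _
  | a10_add a b c h =>
    simp only [pcSystem, PICircuit.unfold_add, PICircuit.unfold_const]
    exact UCEq.const_add a b c h
  | a10_mul a b c h =>
    simp only [pcSystem, PICircuit.unfold_mul, PICircuit.unfold_const]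
    exact UCEq.const_mul a b c h

/-- **Soundness for `P_c`.** In a `P_c` proof with no instance of A6, both sides of every line
unfold to UC-equivalent formulas (C1/C2 instances have literally equal unfoldings). [folklore] -/
theorem ucEq_unfold_of_pcProof {Γ : List (PICircuit 𝔽 X × PICircuit 𝔽 X)} (π : PCProof 𝔽 X Γ)
    (h : ∀ s, IsDist s → π.axiomCount s = 0) :
    ∀ {F G : PICircuit 𝔽 X}, (F, G) ∈ Γ → UCEq F.unfold G.unfold := by
  induction π with
  | nil => intro F G hm; simp at hm
  | axm s' hax π ih =>
    intro F G hm
    have hπ : ∀ s, IsDist s → π.axiomCount s = 0 := fun s hs => by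
      have := h s hs; simp only [PIProof.axiomCount] at this; omega
    have hs' : ¬ IsDist s' := fun hs => by
      have := h s' hs; simp [PIProof.axiomCount] at this
    rcases List.mem_cons.1 hm with hm | hm
    · obtain ⟨rfl, rfl⟩ := Prod.mk.injEq _ _ _ _ ▸ hm
      rcases hax with hax | hax
      · exact ucEq_unfold_of_ringAxiom hs' hax
      · rw [show F.unfold = G.unfold from PICircuit.IsExtra.unfold_eq hax]; exact .refl _
    · exact ih hπ hm
  | symm hm' π ih =>
    intro F G hm
    rcases List.mem_cons.1 hm with hm | hm
    · obtain ⟨rfl, rfl⟩ := Prod.mk.injEq _ _ _ _ ▸ hm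
      exact (ih h hm').symm
    · exact ih h hm
  | trans h₁ h₂ π ih =>
    intro F G hm
    rcases List.mem_cons.1 hm with hm | hm
    · obtain ⟨rfl, rfl⟩ := Prod.mk.injEq _ _ _ _ ▸ hm
      exact (ih h h₁).trans (ih h h₂)
    · exact ih h hm
  | addRule h₁ h₂ hF hG π ih =>
    intro F G hm
    rcases List.mem_cons.1 hm with hm | hm
    · obtain ⟨rfl, rfl⟩ := Prod.mk.injEq _ _ _ _ ▸ hm
      subst hF hG
      simpa [pcSystem] using UCEq.add_congr (ih h h₁) (ih h h₂)
    · exact ih h hm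
  | mulRule h₁ h₂ hF hG π ih =>
    intro F G hm
    rcases List.mem_cons.1 hm with hm | hm
    · obtain ⟨rfl, rfl⟩ := Prod.mk.injEq _ _ _ _ ▸ hm
      subst hF hG
      simpa [pcSystem] using UCEq.mul_congr (ih h h₁) (ih h h₂)
    · exact ih h hm

/-- If `F = G` has a `P_c` proof within a budget vanishing on A6, then `F` and `G` unfold to
UC-equivalent formulas. [folklore] -/
theorem ucEq_unfold_of_hasPCProof {F G : PICircuit 𝔽 X} {b : PIAxiom → ℕ∞}
    (hb : ∀ s, IsDist s → b s = 0) (h : HasPCProof F G b) : UCEq F.unfold G.unfold := by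
  obtain ⟨Γ, π, -, hπ⟩ := h
  refine ucEq_unfold_of_pcProof π (fun s hs => ?_) List.mem_cons_self
  have := hπ s
  rw [hb s hs, nonpos_iff_eq_zero, Nat.cast_eq_zero] at this
  exact this

end ACStability

open Literature.Computability.AlgebraicComplexity in
/-- **Soundness for the budget of rung S3⁗** (helper under stub S2″ `stub_proofsToACEquiv`, crux
`RestorationQP`): a `P_c(ℂ)` proof of `F = G` using no instance of distributivity A6 — unit laws
A7–A9 and constant equations A10 allowed — forces the unfoldings of `F` and `G` to be equal modulo
associativity, commutativity, the unit laws and the constant equations. [folklore] -/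
theorem proofsToACEquiv_aux_distSound : ∀ (n : ℕ) (F G : PICircuit ℂ (Fin n × Fin n)), HasPCProof F G (fun s => if s = PIAxiom.A6 then 0 else ⊤) → ACStability.UCEq F.unfold G.unfold := by
  intro n F G h
  exact ACStability.ucEq_unfold_of_hasPCProof (fun s hs => if_pos hs) h

end Summit.ValiantsHypothesis.ValiantsHypothesis.Theorems
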